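import Summits.ResolutionOfSingularities.ResolutionOfSingularities.Theorems.WildConesClassicalRegimesStubMuDropCharTwoOrdPSurface

/-!
# Milnor drop in characteristic two (`stub_muDropCharTwoOrdP`) — helper: Embed (descent bookkeeping and the formal drop)

Helper file for the stub `stub_muDropCharTwoOrdP` of crux `ClassicalRegimes`
(stmt-ResolutionOfSingularities-16884, route `WildCones`, line `milnor-descent`; chain W4.1 piece
"support for (S)"): the one-step drop of the Milnor number `μ = dim_κ κ⟦u₁,…,uₙ⟧/(∂a)` of the
cleaned state of `z² = a(u)` under the point-blow-up dynamics in characteristic two, `n ≥ 3`.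

The descent `descent_step` (helper 4/8, `…StubMuDropCharTwoOrdPDescent.lean`) kills a hyperbolic
pair `u_j u_l` (`j ≠ l`, both different from the chart index `i`) and lands in `m` variables along
ANY embedding `e : Fin m ↪ Fin n` whose range is the complement of `{j, l}`, at the chart index `i'`
with `e i' = i`. This file supplies the bookkeeping the induction on `n` needs:

* `exists_compl_embedding` — such an embedding `Fin (n - 2) ↪ Fin n` exists, and it can be chosen
  with `i' = 0` (precompose the increasing enumeration of the complement with a transposition).
  Choosing the new chart index to be `0` at every descent means the surface leaf (`n = 2`) is only
  ever reached at chart `X 0`, which is how `surface_drop` (helper 8/8) is stated — no chart swap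
  is needed anywhere in the induction.
* `descent_package` — `descent_step` along that embedding, with the Milnor algebras' finiteness
  transported and their `κ`-dimensions identified along the two algebra isomorphisms
  (`Module.Finite.equiv`, `LinearEquiv.finrank_eq`).
* `drop_step` — THE DESCENT STEP OF THE FORMAL DROP: if the one-step drop holds in `n - 2`
  variables at chart index `0`, then it holds in `n ≥ 3` variables at every chart index
  (a square-free quadratic monomial of `a` gives one avoiding the chart index by `exists_pair_ne`,
  helper 2/8, and the package descends; without such a monomial the successor is not isolated,
  `caseA_not_finite`, helper 5/8).
* `formal_drop` / `formal_drop_of_three_le` — THE FORMAL ONE-STEP MILNOR DROP for every `n`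
  (strong induction on `n` with the invariant "`n = 2 →` chart index `0`"; leaves `curve_drop`,
  helper 5/8, and `surface_drop`, helper 8/8): for `a` of order `≥ 2` and `G` without linear terms
  with `X_i² G = a∘Φ_{i,τ}`, both Milnor algebras finite, `dim_κ κ⟦X⟧/(∂G) < dim_κ κ⟦X⟧/(∂a)`.
  What remains for the stub `stub_muDropCharTwoOrdP` after this file is only the dictionary between
  the route's coefficient calculus (`step`, `ser`, `jac`, `mu`) and this formal statement.

Sources: G.-M. Greuel, G. Pfister, *The splitting lemma in any characteristic*, J. Algebra 689
(2026) = arXiv:2507.17078, Thm. 3.5 / Cor. 3.7 (the hyperbolic pair, used inside `descent_step`);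
everything in this file is elementary bookkeeping. [folklore]
-/

noncomputable section

-- single-problem summit: the doubled namespace component `ResolutionOfSingularities` is forced
set_option linter.dupNamespace false

open scoped BigOperators Classical

open MvPowerSeries IsLocalRing

open Literature.AlgebraicGeometry.Resolution

namespace Summit.ResolutionOfSingularities.ResolutionOfSingularities.Theorems.WildCones

namespace MuDropCharTwoOrdP

variable {κ : Type} [Field κ]

section Embed

/-- THE COMPLEMENT EMBEDDING: for `j ≠ l` in `Fin n` and `i ∉ {j, l}` there is an embedding
`e : Fin (n - 2) ↪ Fin n` with range `{s | s ≠ j ∧ s ≠ l}` hitting `i` at the index `0`.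
[folklore] -/
theorem exists_compl_embedding {n : ℕ} {j l i : Fin n} (hjl : j ≠ l) (hij : i ≠ j) (hil : i ≠ l) :
    ∃ (e : Fin (n - 2) ↪ Fin n) (i' : Fin (n - 2)),
      (∀ s, s ∈ Set.range e ↔ s ≠ j ∧ s ≠ l) ∧ e i' = i ∧ (i' : ℕ) = 0 := by
  set S : Finset (Fin n) := (Finset.univ.erase j).erase l with hS
  have hmemS : ∀ s, s ∈ S ↔ s ≠ j ∧ s ≠ l := fun s => by
    simp only [hS, Finset.mem_erase, Finset.mem_univ, and_true]
    tauto
  have hcard : S.card = n - 2 := by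
    have hl : l ∈ Finset.univ.erase j := by simpa using Ne.symm hjl
    rw [hS, Finset.card_erase_of_mem hl, Finset.card_erase_of_mem (Finset.mem_univ j),
      Finset.card_univ, Fintype.card_fin]
    omega
  set f := S.orderEmbOfFin hcard with hf
  have hrange : ∀ s, s ∈ Set.range f ↔ s ≠ j ∧ s ≠ l := fun s => by
    rw [hf, Finset.range_orderEmbOfFin, Finset.mem_coe, hmemS]
  obtain ⟨t₀, ht₀⟩ : i ∈ Set.range f := (hrange i).mpr ⟨hij, hil⟩
  set z : Fin (n - 2) := ⟨0, Fin.pos t₀⟩ with hz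
  refine ⟨(Equiv.swap z t₀).toEmbedding.trans f.toEmbedding, z, fun s => ?_, ?_, rfl⟩
  · rw [← hrange s]
    constructor
    · rintro ⟨t, rfl⟩
      exact ⟨Equiv.swap z t₀ t, rfl⟩
    · rintro ⟨t, rfl⟩
      refine ⟨Equiv.swap z t₀ t, ?_⟩
      simp [Function.Embedding.trans_apply, Equiv.swap_apply_self]
  · simp [Function.Embedding.trans_apply, Equiv.swap_apply_left, ht₀]

/-- THE DESCENT PACKAGE (characteristic two). Let `X_i² G = a∘Φ_{i,τ}` with `ord a ≥ 2`, `G`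
without linear terms, and `[X_j X_l] a ≠ 0` for a pair `j ≠ l` avoiding `i`. Then in `n - 2`
variables there are `a', G'` in the same relation at chart index `0`, with `ord a' ≥ 2`, `G'`
without linear terms, and Milnor algebras of `a'`, `G'` isomorphic to those of `a`, `G`: finiteness
descends and the `κ`-dimensions agree. (`descent_step` along `exists_compl_embedding`.) [folklore] -/
theorem descent_package [CharP κ 2] {n : ℕ} (i : Fin n) (τ : Fin n → κ)
    {a G : MvPowerSeries (Fin n) κ}
    (ha : 2 ≤ a.order) (hG0 : ∀ s, coeff (Finsupp.single s 1) G = 0)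
    (hG : X i ^ 2 * G = subst (fun s => if s = i then (X i : MvPowerSeries (Fin n) κ)
      else X i * (X s + C (τ s))) a)
    {j l : Fin n} (hjl : j ≠ l) (hj : j ≠ i) (hl : l ≠ i)
    (hq : coeff (Finsupp.single j 1 + Finsupp.single l 1) a ≠ 0) :
    ∃ (i' : Fin (n - 2)) (τ' : Fin (n - 2) → κ) (a' G' : MvPowerSeries (Fin (n - 2)) κ),
      (i' : ℕ) = 0 ∧ 2 ≤ a'.order ∧ (∀ t, coeff (Finsupp.single t 1) G' = 0) ∧
      X i' ^ 2 * G' = subst (fun t => if t = i' then (X i' : MvPowerSeries (Fin (n - 2)) κ)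
        else X i' * (X t + C (τ' t))) a' ∧
      (Module.Finite κ (MvPowerSeries (Fin n) κ ⧸
          Ideal.span (Set.range fun s => MvPowerSeries.pderiv s a)) →
        Module.Finite κ (MvPowerSeries (Fin (n - 2)) κ ⧸
          Ideal.span (Set.range fun t => MvPowerSeries.pderiv t a'))) ∧
      (Module.Finite κ (MvPowerSeries (Fin n) κ ⧸
          Ideal.span (Set.range fun s => MvPowerSeries.pderiv s G)) →
        Module.Finite κ (MvPowerSeries (Fin (n - 2)) κ ⧸
          Ideal.span (Set.range fun t => MvPowerSeries.pderiv t G'))) ∧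
      Module.finrank κ (MvPowerSeries (Fin (n - 2)) κ ⧸
          Ideal.span (Set.range fun t => MvPowerSeries.pderiv t a')) =
        Module.finrank κ (MvPowerSeries (Fin n) κ ⧸
          Ideal.span (Set.range fun s => MvPowerSeries.pderiv s a)) ∧
      Module.finrank κ (MvPowerSeries (Fin (n - 2)) κ ⧸
          Ideal.span (Set.range fun t => MvPowerSeries.pderiv t G')) =
        Module.finrank κ (MvPowerSeries (Fin n) κ ⧸
          Ideal.span (Set.range fun s => MvPowerSeries.pderiv s G)) := by
  obtain ⟨e, i', he, hi', hi'0⟩ := exists_compl_embedding hjl (Ne.symm hj) (Ne.symm hl)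
  obtain ⟨a', G', ha', hG0', hG', ⟨εa⟩, ⟨εG⟩⟩ := descent_step i τ ha hG0 hG hjl hj hl hq e he i' hi'
  refine ⟨i', fun t => τ (e t), a', G', hi'0, ha', hG0', hG', fun h => ?_, fun h => ?_,
    εa.toLinearEquiv.finrank_eq.symm, εG.toLinearEquiv.finrank_eq.symm⟩
  · haveI := h
    exact Module.Finite.equiv εa.toLinearEquiv
  · haveI := h
    exact Module.Finite.equiv εG.toLinearEquiv

/-- **THE DESCENT STEP OF THE FORMAL DROP** (characteristic two, `n ≥ 3`): if the one-step Milnor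
drop holds in `n - 2` variables at chart index `0`, then it holds in `n` variables at every chart
index. With a square-free quadratic monomial in `a`, `exists_pair_ne` gives one avoiding the chart
index and `descent_package` descends; without one, the isolated successor contradicts
`caseA_not_finite`. [folklore] -/
theorem drop_step [CharP κ 2] {n : ℕ} (hn : 3 ≤ n)
    (IH : ∀ (i : Fin (n - 2)) (τ : Fin (n - 2) → κ) (a G : MvPowerSeries (Fin (n - 2)) κ),
      (i : ℕ) = 0 → 2 ≤ a.order → (∀ s, coeff (Finsupp.single s 1) G = 0) →
      X i ^ 2 * G = subst (fun s => if s = i then (X i : MvPowerSeries (Fin (n - 2)) κ)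
        else X i * (X s + C (τ s))) a →
      Module.Finite κ (MvPowerSeries (Fin (n - 2)) κ ⧸
        Ideal.span (Set.range fun s => MvPowerSeries.pderiv s a)) →
      Module.Finite κ (MvPowerSeries (Fin (n - 2)) κ ⧸
        Ideal.span (Set.range fun s => MvPowerSeries.pderiv s G)) →
      Module.finrank κ (MvPowerSeries (Fin (n - 2)) κ ⧸
          Ideal.span (Set.range fun s => MvPowerSeries.pderiv s G)) <
        Module.finrank κ (MvPowerSeries (Fin (n - 2)) κ ⧸
          Ideal.span (Set.range fun s => MvPowerSeries.pderiv s a)))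
    (i : Fin n) (τ : Fin n → κ) {a G : MvPowerSeries (Fin n) κ}
    (ha : 2 ≤ a.order) (hG0 : ∀ s, coeff (Finsupp.single s 1) G = 0)
    (hG : X i ^ 2 * G = subst (fun s => if s = i then (X i : MvPowerSeries (Fin n) κ)
      else X i * (X s + C (τ s))) a)
    (hfa : Module.Finite κ (MvPowerSeries (Fin n) κ ⧸
      Ideal.span (Set.range fun s => MvPowerSeries.pderiv s a)))
    (hfG : Module.Finite κ (MvPowerSeries (Fin n) κ ⧸
      Ideal.span (Set.range fun s => MvPowerSeries.pderiv s G))) :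
    Module.finrank κ (MvPowerSeries (Fin n) κ ⧸
        Ideal.span (Set.range fun s => MvPowerSeries.pderiv s G)) <
      Module.finrank κ (MvPowerSeries (Fin n) κ ⧸
        Ideal.span (Set.range fun s => MvPowerSeries.pderiv s a)) := by
  by_cases hpair : ∃ j l : Fin n, j ≠ l ∧ coeff (Finsupp.single j 1 + Finsupp.single l 1) a ≠ 0
  · obtain ⟨j, l, hjl, hj, hl, hq⟩ := exists_pair_ne i τ ha hG hG0 hpair
    obtain ⟨i', τ', a', G', hi'0, ha', hG0', hG', hfa', hfG', hμa, hμG⟩ :=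
      descent_package i τ ha hG0 hG hjl hj hl hq
    rw [← hμa, ← hμG]
    exact IH i' τ' a' G' hi'0 ha' hG0' hG' (hfa' hfa) (hfG' hfG)
  · push Not at hpair
    exact absurd hfG (caseA_not_finite hn i τ ha hG hG0 fun j l hjl => hpair j l hjl)

/-- **THE FORMAL ONE-STEP MILNOR DROP** (characteristic two, every `n`, by strong induction on
`n` in steps of two): for `a` of order `≥ 2` and its strict transform `G` without linear terms
(`X_i² G = a∘Φ_{i,τ}`), both with finite Milnor algebra, `dim_κ κ⟦X⟧/(∂G) < dim_κ κ⟦X⟧/(∂a)`.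
The side condition "`n = 2 →` chart index `0`" is the invariant maintained by `drop_step`
(`exists_compl_embedding` puts the new chart index at `0`); it makes the surface leaf exactly
`surface_drop`. Leaves: `n = 0` vacuous, `n = 1` `curve_drop`, `n = 2` `surface_drop` (a pair
avoiding the chart index cannot exist in two variables, `exists_pair_ne`), `n ≥ 3` `drop_step`.
[folklore] -/
theorem formal_drop [CharP κ 2] :
    ∀ (n : ℕ) (i : Fin n) (τ : Fin n → κ) (a G : MvPowerSeries (Fin n) κ),
      (n = 2 → (i : ℕ) = 0) → 2 ≤ a.order → (∀ s, coeff (Finsupp.single s 1) G = 0) →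
      X i ^ 2 * G = subst (fun s => if s = i then (X i : MvPowerSeries (Fin n) κ)
        else X i * (X s + C (τ s))) a →
      Module.Finite κ (MvPowerSeries (Fin n) κ ⧸
        Ideal.span (Set.range fun s => MvPowerSeries.pderiv s a)) →
      Module.Finite κ (MvPowerSeries (Fin n) κ ⧸
        Ideal.span (Set.range fun s => MvPowerSeries.pderiv s G)) →
      Module.finrank κ (MvPowerSeries (Fin n) κ ⧸
          Ideal.span (Set.range fun s => MvPowerSeries.pderiv s G)) <
        Module.finrank κ (MvPowerSeries (Fin n) κ ⧸
          Ideal.span (Set.range fun s => MvPowerSeries.pderiv s a)) := by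
  intro n
  induction n using Nat.strong_induction_on with
  | _ n IHn =>
  intro i τ a G hi2 ha hG0 hG hfa hfG
  rcases Nat.lt_or_ge n 3 with hlt | hge
  · interval_cases n
    · exact i.elim0
    · exact curve_drop i τ hG hfG
    · have hi : i = 0 := Fin.ext (hi2 rfl)
      subst hi
      have hnopair : coeff (Finsupp.single 0 1 + Finsupp.single 1 1) a = 0 := by
        by_contra hne
        obtain ⟨j, l, hjl, hj, hl, -⟩ := exists_pair_ne 0 τ ha hG hG0 ⟨0, 1, by decide, hne⟩
        have h1 : ∀ s : Fin 2, s ≠ 0 → s = 1 := by decide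
        exact hjl ((h1 j hj).trans (h1 l hl).symm)
      exact surface_drop τ ha hnopair hG hfa hfG
  · exact drop_step hge (fun i' τ' a' G' hi'0 => IHn (n - 2) (by omega) i' τ' a' G' fun _ => hi'0)
      i τ ha hG0 hG hfa hfG

/-- **THE FORMAL ONE-STEP MILNOR DROP, `n ≥ 3`** (the form the stub consumes: no side condition
on the chart index). [folklore] -/
theorem formal_drop_of_three_le [CharP κ 2] {n : ℕ} (hn : 3 ≤ n) (i : Fin n) (τ : Fin n → κ)
    {a G : MvPowerSeries (Fin n) κ}
    (ha : 2 ≤ a.order) (hG0 : ∀ s, coeff (Finsupp.single s 1) G = 0)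
    (hG : X i ^ 2 * G = subst (fun s => if s = i then (X i : MvPowerSeries (Fin n) κ)
      else X i * (X s + C (τ s))) a)
    (hfa : Module.Finite κ (MvPowerSeries (Fin n) κ ⧸
      Ideal.span (Set.range fun s => MvPowerSeries.pderiv s a)))
    (hfG : Module.Finite κ (MvPowerSeries (Fin n) κ ⧸
      Ideal.span (Set.range fun s => MvPowerSeries.pderiv s G))) :
    Module.finrank κ (MvPowerSeries (Fin n) κ ⧸
        Ideal.span (Set.range fun s => MvPowerSeries.pderiv s G)) <
      Module.finrank κ (MvPowerSeries (Fin n) κ ⧸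
        Ideal.span (Set.range fun s => MvPowerSeries.pderiv s a)) :=
  formal_drop n i τ a G (fun h => absurd hn (by omega)) ha hG0 hG hfa hfG

end Embed

end MuDropCharTwoOrdP

end Summit.ResolutionOfSingularities.ResolutionOfSingularities.Theorems.WildCones

end
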